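import Summits.QuantumFields.YangMills.Theorems.BalabanUVNodesN21ThresholdMixtureTransfer

/-!
# YM-DAG node N21 (= NE7c) — THE THRESHOLD MIXTURE, PART 17′: VACUITY GUARD for the transfer theorem — a threshold-indexed sharp family whose
# OWN shell clause FAILS on a set of positive measure at every step (and at the nominal diagonal), while `hybridNE7_of_average_of_shellWeightBound`
# FIRES for its averaged carriers with a summable shell budget

Track A of `YM-PLAN.md` (cell `pub-ymgap`, HUMAN RULING D-0062), node **N21**; R141 (C) fan-out seat `pub-ymgap-dag-n21-e` (s3 = ALTERNATIVE
CURRENCY), generation 7, guard of file 17 `…N21ThresholdMixtureTransfer`.  Lane K3⁗ `SpineGivenEndpointR13Sep` = stmt-QuantumFields-20292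
(`--kind proof --supports … --as helper`).

THE TOY (the straddle mechanism of the mixture road in one slot).  One term (`ι = Unit`), no bad class, `W = δ = 0`, `vol = l₀ = 1`; threshold
multipliers `λ ∈ [0, 1]` with Lebesgue measure (a probability space); both runs' sharp term weights `≡ 1`; the SHARP shell part at multiplier `λ` is the
straddle indicator `1[λ ≤ w_K]` with `w_K = (1∕2)^K ∕ 4` (the tested variables of the two runs straddle the threshold `λθ` exactly for the multipliers in a
window of relative width `w_K` — the two-run width of N16).  THEN: at every `λ ≤ w_K` the sharp shell part IS the whole term, so the sharp relative shell
bound fails for every constant `< 1` (`toy_sharp_shell_fails`) on a set of `P K`-measure `w_K > 0` (`toy_sharp_shell_not_ae`), and at the nominal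
DIAGONAL `λ ≡ 0` NO summable budget works (`toy_not_shellWeightBound_diagonal`); the AVERAGED shell part is `w_K` (`toy_shA`), summable, and file 17's
★★ delivers `HybridNE7 1 1 T A B Bad 0 shA shB w 0` (`toy_hybridNE7_of_average`).  Shows the binders of ★★ are jointly inhabited in the regime the
mixture road is FOR (sharp shell clause unavailable, averaged one cheap); the content of NE7c is in its producers.

HONEST FRAMING.  A toy; nothing of Bałaban's asserted; NE7c NOT PRINTED ∕ NOT proved; N21 NOT discharged; counts unmoved (typed 28∕28 · discharged
5∕27, A 5∕28); one finite 𝕋⁴ at fixed ε — NOT ℝ⁴ ∕ OS ∕ mass gap ∕ Clay.  No `sorry`, no `axiom`, no `def`, no `instance`, no `notation`.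
-/

noncomputable section

open MeasureTheory Set Filter
open scoped BigOperators ENNReal Topology

namespace Summit.QuantumFields.YangMills.Theorems.N21ThresholdMixtureTransferSanity

open Literature.MathematicalPhysics.QuantumFieldTheory.Balaban1983to89
open Literature.MathematicalPhysics.QuantumFieldTheory.Balaban1983to89.T4IndicatorShell (ShellWeightBound)
open Literature.MathematicalPhysics.QuantumFieldTheory.Balaban1983to89.T4MatchingAssembly (HybridNE7)
open N21ThresholdMixtureTransfer (hybridNE7_of_average_of_shellWeightBound)

/-! ## §1  The toy's numbers -/

/-- The width `w_K = (1∕2)^K ∕ 4` is positive. [folklore] -/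
theorem toy_w_pos (K : ℕ) : 0 < ((1 : ℝ) / 2) ^ K / 4 := by positivity

/-- … and at most `1∕4`. [folklore] -/
theorem toy_w_le (K : ℕ) : ((1 : ℝ) / 2) ^ K / 4 ≤ 1 / 4 := by
  have h : ((1 : ℝ) / 2) ^ K ≤ 1 := pow_le_one₀ (by norm_num) (by norm_num)
  linarith

/-- … hence summable (a geometric series). [folklore] -/
theorem toy_w_summable : Summable fun K : ℕ => ((1 : ℝ) / 2) ^ K / 4 :=
  (summable_geometric_of_lt_one (by norm_num) (by norm_num)).div_const 4

/-- The averaged term weight: `∫_{[0,1]} 1 dλ = 1`. [folklore] -/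
theorem toy_A : ∫ _l in Icc (0 : ℝ) 1, (1 : ℝ) = 1 := by
  rw [setIntegral_const, Real.volume_real_Icc_of_le zero_le_one]
  norm_num

/-- The averaged shell part: `∫_{[0,1]} 1[λ ≤ w] dλ = w` for `0 ≤ w ≤ 1` — the straddle window's relative width. [folklore] -/
theorem toy_shA {w : ℝ} (hw0 : 0 ≤ w) (hw1 : w ≤ 1) :
    ∫ l in Icc (0 : ℝ) 1, (Icc 0 w).indicator (fun _ => (1 : ℝ)) l = w := by
  rw [integral_indicator measurableSet_Icc, Measure.restrict_restrict measurableSet_Icc,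
    Set.inter_eq_left.2 (Icc_subset_Icc_right hw1), setIntegral_const, Real.volume_real_Icc_of_le hw0]
  simp

/-! ## §2  The sharp shell clause FAILS on a set of positive measure, and at the diagonal -/

/-- At a multiplier inside the straddle window the sharp shell part is the WHOLE term: no constant `c < 1` bounds it. [folklore] -/
theorem toy_sharp_shell_fails {w l c : ℝ} (hl : l ∈ Icc 0 w) (hc : c < 1) :
    ¬ (∑ _τ ∈ ({()} : Finset Unit), (Icc 0 w).indicator (fun _ => (1 : ℝ)) l ≤
        c * ∑ _τ ∈ ({()} : Finset Unit), (1 : ℝ)) := by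
  rw [Finset.sum_singleton, Finset.sum_singleton, Set.indicator_of_mem hl, mul_one]
  exact not_le.2 hc

/-- … and the straddle window has measure `w_K > 0` under the multiplier law, so the sharp relative shell bound with any constant `c < 1` does NOT
hold almost everywhere — the sharp shell clause is genuinely unavailable to the all-sharp transfer `hybridNE7_of_average`. [folklore] -/
theorem toy_sharp_shell_not_ae {w c : ℝ} (hw0 : 0 < w) (hw1 : w ≤ 1) (hc : c < 1) :
    ¬ (∀ᵐ l ∂(volume.restrict (Icc (0 : ℝ) 1)),
        ∑ _τ ∈ ({()} : Finset Unit), (Icc 0 w).indicator (fun _ => (1 : ℝ)) l ≤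
          c * ∑ _τ ∈ ({()} : Finset Unit), (1 : ℝ)) := by
  intro h
  rw [ae_iff, Measure.restrict_apply' measurableSet_Icc] at h
  have hsub : Icc (0 : ℝ) w ⊆ {l | ¬ (∑ _τ ∈ ({()} : Finset Unit), (Icc 0 w).indicator (fun _ => (1 : ℝ)) l ≤
      c * ∑ _τ ∈ ({()} : Finset Unit), (1 : ℝ))} ∩ Icc 0 1 :=
    fun l hl => ⟨toy_sharp_shell_fails hl hc, Icc_subset_Icc_right hw1 hl⟩
  have hpos : 0 < volume (Icc (0 : ℝ) w) := by
    rw [Real.volume_Icc, sub_zero]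
    exact ENNReal.ofReal_pos.2 hw0
  exact (lt_of_lt_of_le hpos (measure_mono hsub)).ne' h

/-- At the nominal DIAGONAL `λ ≡ 0` (every step's multiplier at the straddle point) the sharp family admits NO shell budget at all: its shell part is
the whole term at every `K`, so `Wsh K ≥ 1` for all `K`, which is not summable. [folklore] -/
theorem toy_not_shellWeightBound_diagonal (T : ℕ → Finset Unit) (hT : ∀ K, T K = {()}) :
    ¬ ∃ Wsh : ℕ → ℝ, ShellWeightBound (1 : ℝ) T (fun _ _ _ => (1 : ℝ)) (fun _ _ _ => (1 : ℝ))
      (fun K _ _ => (Icc 0 (((1 : ℝ) / 2) ^ K / 4)).indicator (fun _ => (1 : ℝ)) 0)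
      (fun K _ _ => (Icc 0 (((1 : ℝ) / 2) ^ K / 4)).indicator (fun _ => (1 : ℝ)) 0) Wsh := by
  rintro ⟨Wsh, h⟩
  have hge : ∀ K, 1 ≤ Wsh K := fun K => by
    have hl : (0 : ℝ) ∈ Icc 0 (((1 : ℝ) / 2) ^ K / 4) := ⟨le_rfl, (toy_w_pos K).le⟩
    have := h.left K 0 (by simp)
    rw [hT K, Finset.sum_singleton, Finset.sum_singleton, Set.indicator_of_mem hl, mul_one] at this
    exact this
  have hlim := h.summable.tendsto_atTop_zero
  have hev : ∀ᶠ K in atTop, Wsh K < 1 := hlim (Iio_mem_nhds zero_lt_one)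
  obtain ⟨K, hK⟩ := hev.exists
  exact absurd (hge K) (not_le.2 hK)

/-! ## §3  … while the transfer theorem fires for the averaged carriers -/

/-- The AVERAGED shell budget `Wsh = w` IS a shell-weight bound for the averaged carriers (term weight `1`, shell part `w_K`). [folklore] -/
theorem toy_shellWeightBound_average (T : ℕ → Finset Unit) :
    ShellWeightBound (1 : ℝ) T (fun _ _ _ => (1 : ℝ)) (fun _ _ _ => (1 : ℝ)) (fun K _ _ => ((1 : ℝ) / 2) ^ K / 4)
      (fun K _ _ => ((1 : ℝ) / 2) ^ K / 4) (fun K => ((1 : ℝ) / 2) ^ K / 4) where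
  nonneg K := (toy_w_pos K).le
  summable := toy_w_summable
  sh_nonneg_left K _ _ _ _ := (toy_w_pos K).le
  sh_le_left K _ _ _ _ := (toy_w_le K).trans (by norm_num)
  sh_nonneg_right K _ _ _ _ := (toy_w_pos K).le
  sh_le_right K _ _ _ _ := (toy_w_le K).trans (by norm_num)
  left K t _ := by
    rw [Finset.sum_const, Finset.sum_const, nsmul_eq_mul, nsmul_eq_mul, mul_one]
    exact (mul_comm _ _).le
  right K t _ := by
    rw [Finset.sum_const, Finset.sum_const, nsmul_eq_mul, nsmul_eq_mul, mul_one]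
    exact (mul_comm _ _).le

/-- ★ **THE TRANSFER THEOREM FIRES** for the toy: the sharp weight clause (empty bad class) and the sharp core sandwich (`c = 0`: both runs' cores
EQUAL at every multiplier) hold at EVERY `λ`, the averaged shell bound is `toy_shellWeightBound_average`, and file 17's
`hybridNE7_of_average_of_shellWeightBound` returns `HybridNE7` for the averaged carriers — in the regime where the sharp shell clause is unavailable
(§2). [folklore] -/
theorem toy_hybridNE7_of_average :
    HybridNE7 (1 : ℝ) 1 (fun _ => ({()} : Finset Unit)) (fun _ _ _ => (1 : ℝ)) (fun _ _ _ => (1 : ℝ)) (fun _ _ => ∅) (fun _ => 0)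
      (fun K _ _ => ((1 : ℝ) / 2) ^ K / 4) (fun K _ _ => ((1 : ℝ) / 2) ^ K / 4) (fun K => ((1 : ℝ) / 2) ^ K / 4) (fun _ => 0) := by
  refine hybridNE7_of_average_of_shellWeightBound (Λ := fun _ => ℝ) (P := fun _ => volume.restrict (Icc (0 : ℝ) 1))
    (As := fun _ _ _ _ => (1 : ℝ)) (Bs := fun _ _ _ _ => (1 : ℝ))
    (shAs := fun K l _ _ => (Icc 0 (((1 : ℝ) / 2) ^ K / 4)).indicator (fun _ => (1 : ℝ)) l)
    (shBs := fun K l _ _ => (Icc 0 (((1 : ℝ) / 2) ^ K / 4)).indicator (fun _ => (1 : ℝ)) l)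
    (fun K t _ τ _ => integrable_const _) (fun K t _ τ _ => integrable_const _)
    (fun K t _ τ _ => (integrable_const _).indicator measurableSet_Icc)
    (fun K t _ τ _ => (integrable_const _).indicator measurableSet_Icc)
    (fun K t _ τ _ => toy_A.symm) (fun K t _ τ _ => toy_A.symm)
    (fun K t _ τ _ => (toy_shA (toy_w_pos K).le ((toy_w_le K).trans (by norm_num))).symm)
    (fun K t _ τ _ => (toy_shA (toy_w_pos K).le ((toy_w_le K).trans (by norm_num))).symm)
    (fun K t _ => Finset.empty_subset _) (fun _ => le_rfl) summable_zero
    (fun K t _ => ae_of_all _ fun l => by simp) (fun K t _ => ae_of_all _ fun l => by simp)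
    (fun K => ⟨0, fun t _ τ _ => ae_of_all _ fun l => by simp⟩)
    (toy_shellWeightBound_average _) (fun K => by linarith [toy_w_le K]) summable_zero

end Summit.QuantumFields.YangMills.Theorems.N21ThresholdMixtureTransferSanity

end
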